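import Summits.CriticalPhenomena.PercolationContinuityZ3.Theorems.PercNearOneGluingNoHeavyLowerTailTwoPartitionThreeSet
import Mathlib.Data.Fintype.Sum
import Mathlib.Data.Fintype.Powerset
import Mathlib.Data.Fintype.BigOperators
import Mathlib.Algebra.BigOperators.Ring.Finset
import Mathlib.Algebra.Order.BigOperators.Group.Finset
import Mathlib.Tactic.Ring
import HarnessLib.Audit

/-!
# `NoHeavyLowerTail` (crux stmt-CriticalPhenomena-4575), master-family hierarchy P3 (gen 26): the JUNTA LIFT of the three-set
# antipodal functional — `ThreeSetAntipodal` for a single up-set `𝒜'` of a cube `2^ι` implies it for the cylinder `𝒜' × 2^κ` in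
# every larger cube `2^(ι ⊕ κ)`, by an exact identity whose remainder is a sum of two-set Harris–Kleitman sandwiches

Support file (seat `prim-masterthm-p3`; `--supports stmt-CriticalPhenomena-4575`; memo
`run/shared/lean/prim/prim-masterthm/FROM-prim-masterthm-p3-g26-JUNTA-LIFT-AND-K6-CENSUS.md`, HIERARCHY §34).  Companion of
`…TwoPartitionThreeSet` (`threeSetN`, the `@[conjecture] ThreeSetAntipodal`, seven proved faces) and `…TwoPartitionKleitman`
(`twoPartN ≥ 0`, Harris–Kleitman twice).

THE IDENTITY (this work).  Ground set `ι ⊕ κ`; a family `𝒜` of subsets of `ι ⊕ κ` that DEPENDS ONLY ON THE `ι`-PART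
(`S ∈ 𝒜 ↔ S.toLeft ∈ 𝒜'`).  For families `ℬ, 𝒞` write `fib ℬ q = {e ⊆ ι : e ⊎ q ∈ ℬ}` (the fibre over `q ⊆ κ`) and
`sect ℬ e = {q ⊆ κ : e ⊎ q ∈ ℬ}` (the section at `e ⊆ ι`).  Then, with `𝒜' ∩ 𝒜'ᶜˢ` the members of `𝒜'` whose complement (in `ι`)
is also a member,

  `threeSetN 𝒜 ℬ 𝒞 = ∑_{q ⊆ κ} threeSetN 𝒜' (fib ℬ q) (fib 𝒞 q) + ∑_{e ∈ 𝒜' ∩ 𝒜'ᶜˢ} twoPartN (sect ℬ e) (sect 𝒞 eᶜ)`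

(`threeSetN_junta`; pure bookkeeping: the antipode of `e ⊎ q` is `eᶜ ⊎ qᶜ`, and the only terms of `threeSetN` that see the
`κ`-antipode are the `𝒜 ∩ 𝒜ᶜˢ`-terms, which regroup into the sandwiches `#(ℬ_e ∩ 𝒞_{eᶜ}) − #(ℬ_e ∩ (𝒞_{eᶜ})ᶜˢ)`; the `σ(𝒜) ∖ 𝒜`-terms
are rebalanced by the bijection `q ↦ qᶜ`).  Fibres and sections of up-sets are up-sets, and `twoPartN ≥ 0` for up-sets
(`twoPartN_nonneg`), so:

  **`threeSetN_nonneg_of_junta`**: if `0 ≤ threeSetN 𝒜' ℬ' 𝒞'` for all up-sets `ℬ', 𝒞'` of `2^ι` (the conjecture for the ONE up-set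
  `𝒜'` on the small cube), then `0 ≤ threeSetN 𝒜 ℬ 𝒞` for all up-sets `ℬ, 𝒞` of `2^(ι ⊕ κ)` — every `κ`.

CONSEQUENCE (evidence, not in the kernel): `threeSetN ≥ 0` has been verified for ALL triples of up-sets of `2^[k]`, `k ≤ 6`
(`k = 6`: one SAT instance per `S_6`-orbit of `𝒜`, 16 353 classes, all UNSAT — kit job j243546, gen 26; `k ≤ 5`: j237065, gen 25), so
`ThreeSetAntipodal` holds for every `𝒜` depending on at most six coordinates, in every dimension, for all `ℬ, 𝒞`.  A minimal
counterexample to `ThreeSetAntipodal`, if any, has `𝒜` depending on ≥ 7 coordinates.  The same identity lifts pivotal-pair-cone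
certificates.  For `𝒜` NOT a junta the analogous fibre decomposition has a signed remainder (gen 25's `Δ`), so this is not an induction.
HONEST LABEL: an exact identity and a conditional lift; `ThreeSetAntipodal` itself stays a conjecture. [this work]
-/

namespace Summit.CriticalPhenomena.PercolationContinuityZ3.Theorems.TwoPartition

open Finset
open scoped FinsetFamily

variable {ι κ : Type*} [DecidableEq ι] [Fintype ι] [DecidableEq κ] [Fintype κ]

/-! ### Indicator bookkeeping for `twoPartN` / `threeSetN` -/

section chi
variable {τ : Type*} [DecidableEq τ] [Fintype τ]

/-- The `{0,1}`-indicator of a set family, as an integer. [this work] -/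
def chi (𝒳 : Finset (Finset τ)) (S : Finset τ) : ℤ := if S ∈ 𝒳 then 1 else 0

omit [Fintype τ] in
/-- `χ` is multiplicative on intersections. [this work] -/
theorem chi_inter (𝒳 𝒴 : Finset (Finset τ)) (S : Finset τ) : chi (𝒳 ∩ 𝒴) S = chi 𝒳 S * chi 𝒴 S := by
  unfold chi
  simp only [mem_inter]
  split_ifs <;> simp_all

/-- `χ` of the complement family is `χ` at the complement. [this work] -/
theorem chi_compls (𝒳 : Finset (Finset τ)) (S : Finset τ) : chi 𝒳ᶜˢ S = chi 𝒳 Sᶜ := by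
  simp only [chi, mem_compls]

/-- `#𝒳 = ∑_S χ_𝒳(S)`. [this work] -/
theorem card_eq_sum_chi (𝒳 : Finset (Finset τ)) : (#𝒳 : ℤ) = ∑ S, chi 𝒳 S := by
  unfold chi
  rw [Finset.sum_ite_mem, univ_inter, Finset.sum_const, nsmul_eq_mul, mul_one]

/-- `twoPartN` as a sum of indicator products. [this work] -/
theorem twoPartN_eq_sum (𝒰 𝒱 : Finset (Finset τ)) :
    twoPartN 𝒰 𝒱 = ∑ S, (chi 𝒰 S * chi 𝒱 S - chi 𝒰 S * chi 𝒱 Sᶜ) := by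
  unfold twoPartN
  rw [card_eq_sum_chi, card_eq_sum_chi, Finset.sum_sub_distrib]
  simp only [chi_inter, chi_compls]

/-- `threeSetN` as a sum of indicator products. [this work] -/
theorem threeSetN_eq_sum (𝒜 ℬ 𝒞 : Finset (Finset τ)) :
    threeSetN 𝒜 ℬ 𝒞 = ∑ S, (chi 𝒜 S * chi ℬ S * chi 𝒞 S + chi 𝒜 S * chi ℬ S * chi 𝒞 S * chi 𝒜 Sᶜ
      - chi 𝒜 S * chi ℬ S * chi 𝒜 Sᶜ * chi 𝒞 Sᶜ - chi 𝒜 S * chi ℬ Sᶜ * chi 𝒞 Sᶜ) := by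
  unfold threeSetN
  rw [card_eq_sum_chi, card_eq_sum_chi, card_eq_sum_chi, card_eq_sum_chi, Finset.sum_sub_distrib, Finset.sum_sub_distrib,
    Finset.sum_add_distrib]
  simp only [chi_inter, chi_compls]

end chi

/-! ### Fibres and sections over a sum ground set `ι ⊕ κ` -/

/-- The fibre of `ℬ` over `q ⊆ κ`: `{e ⊆ ι : e ⊎ q ∈ ℬ}`. [this work] -/
def fib (ℬ : Finset (Finset (ι ⊕ κ))) (q : Finset κ) : Finset (Finset ι) := univ.filter fun e => e.disjSum q ∈ ℬ

/-- The section of `ℬ` at `e ⊆ ι`: `{q ⊆ κ : e ⊎ q ∈ ℬ}`. [this work] -/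
def sect (ℬ : Finset (Finset (ι ⊕ κ))) (e : Finset ι) : Finset (Finset κ) := univ.filter fun q => e.disjSum q ∈ ℬ

omit [Fintype κ] in
/-- Membership in a fibre. [this work] -/
@[simp] theorem mem_fib {ℬ : Finset (Finset (ι ⊕ κ))} {q : Finset κ} {e : Finset ι} : e ∈ fib ℬ q ↔ e.disjSum q ∈ ℬ := by
  simp [fib]

omit [Fintype ι] in
/-- Membership in a section. [this work] -/
@[simp] theorem mem_sect {ℬ : Finset (Finset (ι ⊕ κ))} {e : Finset ι} {q : Finset κ} : q ∈ sect ℬ e ↔ e.disjSum q ∈ ℬ := by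
  simp [sect]

omit [DecidableEq ι] [DecidableEq κ] in
/-- The complement of `s ⊎ t` in `ι ⊕ κ` is `sᶜ ⊎ tᶜ`. [folklore] -/
theorem compl_disjSum [DecidableEq ι] [DecidableEq κ] (s : Finset ι) (t : Finset κ) : (s.disjSum t)ᶜ = sᶜ.disjSum tᶜ := by
  ext x
  cases x with
  | inl a => simp [mem_compl, inl_mem_disjSum]
  | inr b => simp [mem_compl, inr_mem_disjSum]

omit [Fintype κ] in
/-- `χ` of a fibre. [this work] -/
theorem chi_fib (ℬ : Finset (Finset (ι ⊕ κ))) (q : Finset κ) (e : Finset ι) : chi (fib ℬ q) e = chi ℬ (e.disjSum q) := by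
  simp only [chi, mem_fib]

omit [Fintype ι] in
/-- `χ` of a section. [this work] -/
theorem chi_sect (ℬ : Finset (Finset (ι ⊕ κ))) (e : Finset ι) (q : Finset κ) : chi (sect ℬ e) q = chi ℬ (e.disjSum q) := by
  simp only [chi, mem_sect]

omit [Fintype κ] in
/-- A fibre of an up-set is an up-set. [this work] -/
theorem isUpperSet_fib {ℬ : Finset (Finset (ι ⊕ κ))} (hℬ : IsUpperSet (ℬ : Set (Finset (ι ⊕ κ)))) (q : Finset κ) :
    IsUpperSet ((fib ℬ q : Finset (Finset ι)) : Set (Finset ι)) := by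
  intro e e' hee' he
  rw [Finset.mem_coe, mem_fib] at he ⊢
  exact hℬ (disjSum_mono hee' le_rfl) he

omit [Fintype ι] in
/-- A section of an up-set is an up-set. [this work] -/
theorem isUpperSet_sect {ℬ : Finset (Finset (ι ⊕ κ))} (hℬ : IsUpperSet (ℬ : Set (Finset (ι ⊕ κ)))) (e : Finset ι) :
    IsUpperSet ((sect ℬ e : Finset (Finset κ)) : Set (Finset κ)) := by
  intro q q' hqq' hq
  rw [Finset.mem_coe, mem_sect] at hq ⊢
  exact hℬ (disjSum_mono le_rfl hqq') hq

/-! ### The junta lift -/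

omit [DecidableEq ι] [DecidableEq κ] in
/-- A sum over all subsets of `ι ⊕ κ` is a double sum over the two parts. [folklore] -/
theorem sum_finset_sum_eq (f : Finset (ι ⊕ κ) → ℤ) : ∑ S, f S = ∑ e : Finset ι, ∑ q : Finset κ, f (e.disjSum q) := by
  rw [← Fintype.sum_prod_type']
  exact (Fintype.sum_equiv sumEquiv.toEquiv f (fun p : Finset ι × Finset κ => f (p.1.disjSum p.2))
    (fun S => by simp [toLeft_disjSum_toRight]))

/-- The bijection `q ↦ qᶜ` rebalances a sum. [folklore] -/
theorem sum_comp_compl (g : Finset κ → ℤ) : ∑ q, g qᶜ = ∑ q, g q :=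
  Function.Bijective.sum_comp (compl_bijective) g

/-- **The junta lift identity** (this work).  If `𝒜` depends only on the `ι`-coordinates (`S ∈ 𝒜 ↔ S.toLeft ∈ 𝒜'`) then
`threeSetN 𝒜 ℬ 𝒞` is the sum of the fibrewise functionals `threeSetN 𝒜' ℬ_q 𝒞_q` plus, for each `e ∈ 𝒜' ∩ 𝒜'ᶜˢ`, the two-set
sandwich `twoPartN ℬ^e 𝒞^{eᶜ}` of the sections. [this work] -/
theorem threeSetN_junta {𝒜 ℬ 𝒞 : Finset (Finset (ι ⊕ κ))} {𝒜' : Finset (Finset ι)} (h𝒜 : ∀ S, S ∈ 𝒜 ↔ S.toLeft ∈ 𝒜') :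
    threeSetN 𝒜 ℬ 𝒞 = ∑ q : Finset κ, threeSetN 𝒜' (fib ℬ q) (fib 𝒞 q)
      + ∑ e ∈ 𝒜' ∩ 𝒜'ᶜˢ, twoPartN (sect ℬ e) (sect 𝒞 eᶜ) := by
  -- abbreviations for the atoms
  set a : Finset ι → ℤ := chi 𝒜' with ha_def
  set b : Finset ι → Finset κ → ℤ := fun e q => chi ℬ (e.disjSum q) with hb_def
  set c : Finset ι → Finset κ → ℤ := fun e q => chi 𝒞 (e.disjSum q) with hc_def
  have hA : ∀ (e : Finset ι) (q : Finset κ), chi 𝒜 (e.disjSum q) = a e := by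
    intro e q; simp only [ha_def, chi, h𝒜, toLeft_disjSum]
  -- the three summands, pointwise in `(e, q)`
  let T : Finset ι → Finset κ → ℤ := fun e q =>
    a e * b e q * c e q + a e * b e q * c e q * a eᶜ - a e * b e q * a eᶜ * c eᶜ qᶜ - a e * b eᶜ qᶜ * c eᶜ qᶜ
  let T₁ : Finset ι → Finset κ → ℤ := fun e q =>
    a e * b e q * c e q + a e * b e q * c e q * a eᶜ - a e * b e q * a eᶜ * c eᶜ q - a e * b eᶜ q * c eᶜ q
  let T₂ : Finset ι → Finset κ → ℤ := fun e q => b e q * c eᶜ q - b e q * c eᶜ qᶜ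
  -- left-hand side
  have hL : threeSetN 𝒜 ℬ 𝒞 = ∑ e : Finset ι, ∑ q : Finset κ, T e q := by
    rw [threeSetN_eq_sum, sum_finset_sum_eq]
    simp only [compl_disjSum, hA, T, hb_def, hc_def]
  -- fibre terms
  have hR1 : ∑ q : Finset κ, threeSetN 𝒜' (fib ℬ q) (fib 𝒞 q) = ∑ e : Finset ι, ∑ q : Finset κ, T₁ e q := by
    rw [Finset.sum_comm]
    refine Finset.sum_congr rfl fun q _ => ?_
    rw [threeSetN_eq_sum]
    simp only [chi_fib, T₁, ha_def, hb_def, hc_def]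
  -- section terms, as a sum over all `e` with the weight `χ(e) χ(eᶜ)`
  have hR2 : ∑ e ∈ 𝒜' ∩ 𝒜'ᶜˢ, twoPartN (sect ℬ e) (sect 𝒞 eᶜ) = ∑ e : Finset ι, a e * a eᶜ * ∑ q : Finset κ, T₂ e q := by
    have hpt : ∀ e : Finset ι, a e * a eᶜ * ∑ q : Finset κ, T₂ e q
        = if e ∈ 𝒜' ∩ 𝒜'ᶜˢ then twoPartN (sect ℬ e) (sect 𝒞 eᶜ) else 0 := by
      intro e
      rw [twoPartN_eq_sum]
      simp only [T₂, ha_def, hb_def, hc_def, chi, mem_sect, mem_inter, mem_compls]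
      by_cases h1 : e ∈ 𝒜' <;> by_cases h2 : eᶜ ∈ 𝒜' <;> simp [h1, h2]
    rw [Finset.sum_congr rfl fun e (_ : e ∈ (univ : Finset (Finset ι))) => hpt e, Finset.sum_ite_mem, univ_inter]
  -- the `σ𝒜 ∖ 𝒜`-terms vanish after the bijection `q ↦ qᶜ`; the rest is a pointwise ring identity
  rw [hL, hR1, hR2, ← Finset.sum_add_distrib]
  refine Finset.sum_congr rfl fun e _ => ?_
  have hv : ∑ q : Finset κ, a e * b eᶜ qᶜ * c eᶜ qᶜ = ∑ q : Finset κ, a e * b eᶜ q * c eᶜ q :=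
    sum_comp_compl (fun q => a e * b eᶜ q * c eᶜ q)
  have key : ∀ q : Finset κ, T e q = (T₁ e q + a e * a eᶜ * T₂ e q) + (a e * b eᶜ q * c eᶜ q - a e * b eᶜ qᶜ * c eᶜ qᶜ) := by
    intro q; simp only [T, T₁, T₂]; ring
  rw [Finset.mul_sum, ← Finset.sum_add_distrib, Finset.sum_congr rfl fun q (_ : q ∈ (univ : Finset (Finset κ))) => key q,
    Finset.sum_add_distrib, Finset.sum_sub_distrib, hv, sub_self, add_zero]

/-- **The junta lift of `ThreeSetAntipodal`** (this work): if the three-set antipodal functional of the up-set `𝒜'` of the small cube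
`2^ι` is nonnegative against all up-sets `ℬ', 𝒞'` of `2^ι`, then the functional of the cylinder `𝒜 = {S : S.toLeft ∈ 𝒜'}` is
nonnegative against all up-sets `ℬ, 𝒞` of `2^(ι ⊕ κ)`, for every finite `κ`. [this work] -/
theorem threeSetN_nonneg_of_junta {𝒜 ℬ 𝒞 : Finset (Finset (ι ⊕ κ))} {𝒜' : Finset (Finset ι)}
    (hbase : ∀ ℬ' 𝒞' : Finset (Finset ι), IsUpperSet (ℬ' : Set (Finset ι)) → IsUpperSet (𝒞' : Set (Finset ι)) →
      0 ≤ threeSetN 𝒜' ℬ' 𝒞')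
    (h𝒜 : ∀ S, S ∈ 𝒜 ↔ S.toLeft ∈ 𝒜') (hℬ : IsUpperSet (ℬ : Set (Finset (ι ⊕ κ))))
    (h𝒞 : IsUpperSet (𝒞 : Set (Finset (ι ⊕ κ)))) : 0 ≤ threeSetN 𝒜 ℬ 𝒞 := by
  rw [threeSetN_junta h𝒜]
  refine add_nonneg (Finset.sum_nonneg fun q _ => hbase _ _ (isUpperSet_fib hℬ q) (isUpperSet_fib h𝒞 q))
    (Finset.sum_nonneg fun e _ => twoPartN_nonneg (isUpperSet_sect hℬ e) (isUpperSet_sect h𝒞 eᶜ))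

/-- The same lift with the global conjecture as hypothesis, for record: `ThreeSetAntipodal` on `Fin (card ι)`-many… — stated here in the
directly usable form "`ThreeSetAntipodal` for every triple on `2^ι`" ⟹ the cylinder case. [this work] -/
theorem threeSetN_nonneg_of_junta' {𝒜 ℬ 𝒞 : Finset (Finset (ι ⊕ κ))} {𝒜' : Finset (Finset ι)}
    (hbase : ∀ 𝒜'' ℬ' 𝒞' : Finset (Finset ι), IsUpperSet (𝒜'' : Set (Finset ι)) → IsUpperSet (ℬ' : Set (Finset ι)) →
      IsUpperSet (𝒞' : Set (Finset ι)) → 0 ≤ threeSetN 𝒜'' ℬ' 𝒞')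
    (h𝒜' : IsUpperSet (𝒜' : Set (Finset ι))) (h𝒜 : ∀ S, S ∈ 𝒜 ↔ S.toLeft ∈ 𝒜')
    (hℬ : IsUpperSet (ℬ : Set (Finset (ι ⊕ κ)))) (h𝒞 : IsUpperSet (𝒞 : Set (Finset (ι ⊕ κ)))) : 0 ≤ threeSetN 𝒜 ℬ 𝒞 :=
  threeSetN_nonneg_of_junta (fun ℬ' 𝒞' hℬ' h𝒞' => hbase 𝒜' ℬ' 𝒞' h𝒜' hℬ' h𝒞') h𝒜 hℬ h𝒞

end Summit.CriticalPhenomena.PercolationContinuityZ3.Theorems.TwoPartition
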